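import Summits.RiemannHypothesis.RiemannHypothesis.Theorems.SignConeSignConeOscillatoryStubExtremalExistsLsc
import Literature.NumberTheory.LFunctions.WeilMellinBounds
import Mathlib.Analysis.Calculus.BumpFunction.Normed

/-!
# Line `dual_witness` of crux `SignConeOscillatory` (stmt-RiemannHypothesis-16302): X₂ ⇔ crux, I — mollification of
# windowed finite-energy `L²` functions

Toward `SignConeExtremalNonneg ↔ SignConeOscillatory` (file `…ExtremalNonnegIffCrux.lean`): the analytic input is the
approximation of a windowed `u ∈ L²`, `supp u ⊆ [-a, a]`, of finite archimedean energy `∫ |û(1/2+it)|² |ρ(t)| dt < ∞`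
(`ρ = Re ψ(1/4 + it/2)`), by Weil TESTS on the same window with convergence of node values and of the prime-free Weil
form `reWar`.  This file is the MOLLIFICATION half (Friedrichs): with `Φ_ε` a normalised smooth bump of radius `ε`,
`v_ε = u ⋆ Φ_ε` is a test function with `tsupport v_ε ⊆ [-a-ε, a+ε]`, `v̂_ε = û · Φ̂_ε` on the critical line,
`|Φ̂_ε| ≤ 1`, `|Φ̂_ε(1/2+it) − 1| ≤ ε |t|`; hence by Plancherel `2π ∫|v_ε − u|² = ∫ |û|² |Φ̂_ε − 1|² → 0` and
`∫ |v̂_ε|² ρ → ∫ |û|² ρ` (dominated convergence).  Also: translation is continuous in `L²` on such `u`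
(`2π ∫|u(· − h) − u|² = ∫ |û|² |e^{ith} − 1|² → 0`), so `u ⋆ ũ` is continuous (Cauchy–Schwarz).
The dilation half (pulling the support back into `[-a, a]`, Bombieri's `f_ε`, the tree's `weilDilate` with its uniform
modulus `exists_weilDilate_modulus`) and the assembly are in the sequel files.
-/

noncomputable section

-- `Summit.RiemannHypothesis.RiemannHypothesis.…` repeats a namespace component by design (D-0017 layout).
set_option linter.dupNamespace false

open scoped BigOperators ComplexConjugate Topology ENNReal
open MeasureTheory Set Filter Complex

namespace Summit.RiemannHypothesis.RiemannHypothesis.Theorems.SignCone.DualWitness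

open Literature.NumberTheory.LFunctions Literature.Analysis.SpecialFunctions

/-- Shorthand: the `L²` norm as a real number. [folklore] -/
local notation "N₂" u:arg => ENNReal.toReal (eLpNorm u 2 MeasureTheory.MeasureSpace.volume)

variable {a : ℝ} {u : ℝ → ℂ}

/-! ## Plancherel for differences of windowed / integrable `L²` functions -/

/-- `(u − v)^(1/2+it) = û(1/2+it) − v̂(1/2+it)` for integrable `u, v`. [folklore] -/
theorem weilMellin_half_sub {u v : ℝ → ℂ} (hu : Integrable u) (hv : Integrable v) (t : ℝ) :
    weilMellin (u - v) (1 / 2 + t * I) = weilMellin u (1 / 2 + t * I) - weilMellin v (1 / 2 + t * I) := by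
  have hI : ∀ {w : ℝ → ℂ}, Integrable w → Integrable (fun x : ℝ => w x * cexp (t * I * x)) := by
    intro w hw
    have h := hw.bdd_mul (c := 1) (by fun_prop : Continuous fun x : ℝ => cexp (t * I * x)).aestronglyMeasurable
      (Eventually.of_forall fun x => by
        rw [show (t : ℂ) * I * x = ((t * x : ℝ) : ℂ) * I by push_cast; ring, Complex.norm_exp_ofReal_mul_I])
    simpa only [mul_comm] using h
  rw [add_comm, weilMellin_add_half, weilMellin_add_half, weilMellin_add_half, ← integral_sub (hI hu) (hI hv)]
  refine integral_congr_ae (Eventually.of_forall fun x => ?_)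
  simp only [Pi.sub_apply]; ring

/-- **Plancherel for a difference**: `2π ∫|u − v|² = ∫ |û(1/2+it) − v̂(1/2+it)|²` for `u, v ∈ L¹ ∩ L²`. [folklore] -/
theorem two_pi_mul_integral_norm_sq_sub {u v : ℝ → ℂ} (hu : Integrable u) (hv : Integrable v)
    (hu2 : MemLp u 2 volume) (hv2 : MemLp v 2 volume) :
    2 * Real.pi * ∫ x, ‖u x - v x‖ ^ 2 = ∫ t : ℝ, ‖weilMellin u (1 / 2 + t * I) - weilMellin v (1 / 2 + t * I)‖ ^ 2 := by
  have h := integral_norm_sq_weilMellin_half_of_memLp (hu.sub hv) (hu2.sub hv2)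
  simp only [weilMellin_half_sub hu hv, Pi.sub_apply] at h
  linarith

/-! ## Continuity of translation in `L²` and of the autocorrelation -/

/-- `t ↦ |û(1/2+it)|²` is continuous for a windowed `L²` (hence `L¹`) function. [folklore] -/
theorem continuous_norm_sq_weilMellin_half_line' (hu : MemLp u 2 volume) (hsu : Function.support u ⊆ Icc (-a) a) :
    Continuous fun t : ℝ => ‖weilMellin u (1 / 2 + t * I)‖ ^ 2 := by
  have hui : Integrable u := integrable_of_memLp_two_of_support hu hsu
  have hFc : Continuous (FourierTransform.fourier u) :=
    VectorFourier.fourierIntegral_continuous Real.continuous_fourierChar (by exact continuous_inner) hui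
  have h1 : Continuous fun t : ℝ => ‖FourierTransform.fourier u (-t / (2 * Real.pi))‖ ^ 2 :=
    ((hFc.comp (by fun_prop : Continuous fun t : ℝ => -t / (2 * Real.pi))).norm).pow 2
  refine h1.congr fun t => ?_
  rw [weilMellin_half_eq_fourier]

/-- The critical-line energy density `|û(1/2+it)|²` of a windowed `L²` function is integrable (Plancherel membership).
[folklore] -/
theorem integrable_norm_sq_weilMellin_half (hu : MemLp u 2 volume) (hsu : Function.support u ⊆ Icc (-a) a) :
    Integrable fun t : ℝ => ‖weilMellin u (1 / 2 + t * I)‖ ^ 2 := by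
  have hui : Integrable u := integrable_of_memLp_two_of_support hu hsu
  have hF2 := Literature.Analysis.FunctionSpaces.memLp_two_fourierIntegral hui hu
  have h1 : Integrable (fun ξ : ℝ => ‖FourierTransform.fourier u ξ‖ ^ 2) :=
    (memLp_two_iff_integrable_sq_norm hF2.1).mp hF2
  have h2 := h1.comp_mul_left' (R := -(1 / (2 * Real.pi))) (neg_ne_zero.mpr (by positivity))
  refine h2.congr (Eventually.of_forall fun t => ?_)
  simp only
  rw [weilMellin_half_eq_fourier, show -(1 / (2 * Real.pi)) * t = -t / (2 * Real.pi) by ring]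

/-- **Translation is continuous in `L²` on windowed `L²` functions**: `∫ |u(x − h) − u(x)|² → 0` as `h → 0`
(Plancherel: `2π ∫|u(·−h) − u|² = ∫ |û|² |e^{ith} − 1|²`, dominated convergence). [folklore] -/
theorem tendsto_integral_norm_sq_translate_sub (hu : MemLp u 2 volume) (hsu : Function.support u ⊆ Icc (-a) a) :
    Tendsto (fun h : ℝ => ∫ x, ‖u (x - h) - u x‖ ^ 2) (𝓝 0) (𝓝 0) := by
  have hui : Integrable u := integrable_of_memLp_two_of_support hu hsu
  set U : ℝ → ℝ := fun t => ‖weilMellin u (1 / 2 + t * I)‖ ^ 2 with hU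
  have hUint : Integrable U := integrable_norm_sq_weilMellin_half hu hsu
  have htri : ∀ h : ℝ, Integrable (weilTranslate u h) := fun h => hui.comp_sub_right h
  have htr2 : ∀ h : ℝ, MemLp (weilTranslate u h) 2 volume := fun h =>
    hu.comp_measurePreserving (measurePreserving_sub_right volume h)
  -- Plancherel for the difference, with the phase factor of the translate
  have hP : ∀ h : ℝ, ∫ x, ‖u (x - h) - u x‖ ^ 2 = (1 / (2 * Real.pi)) * ∫ t : ℝ, U t * ‖cexp (t * I * h) - 1‖ ^ 2 := by
    intro h
    have h1 := two_pi_mul_integral_norm_sq_sub (htri h) hui (htr2 h) hu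
    have e : ∫ t : ℝ, ‖weilMellin (weilTranslate u h) (1 / 2 + t * I) - weilMellin u (1 / 2 + t * I)‖ ^ 2 =
        ∫ t : ℝ, U t * ‖cexp (t * I * h) - 1‖ ^ 2 := by
      refine integral_congr_ae (Eventually.of_forall fun t => ?_)
      simp only [hU]
      rw [weilMellin_weilTranslate, show (1 / 2 + (t : ℂ) * I - 1 / 2) * (h : ℂ) = t * I * h by ring,
        show cexp (t * I * h) * weilMellin u (1 / 2 + t * I) - weilMellin u (1 / 2 + t * I) =
          weilMellin u (1 / 2 + t * I) * (cexp (t * I * h) - 1) by ring, norm_mul, mul_pow]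
    rw [e] at h1
    have hpi : (0 : ℝ) < 2 * Real.pi := by positivity
    have : ∫ x, ‖u (x - h) - u x‖ ^ 2 = ∫ x, ‖weilTranslate u h x - u x‖ ^ 2 := rfl
    rw [this]
    field_simp
    linarith
  simp_rw [hP]
  rw [show (0 : ℝ) = (1 / (2 * Real.pi)) * ∫ t : ℝ, U t * ‖cexp (t * I * (0 : ℝ)) - 1‖ ^ 2 by simp]
  refine Tendsto.const_mul _ ?_
  -- dominated convergence in the parameter `h → 0`
  refine tendsto_integral_filter_of_dominated_convergence (fun t => 4 * U t) ?_ ?_ (hUint.const_mul 4) ?_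
  · exact Eventually.of_forall fun h =>
      ((continuous_norm_sq_weilMellin_half_line' hu hsu).mul (by fun_prop)).aestronglyMeasurable
  · refine Eventually.of_forall fun h => Eventually.of_forall fun t => ?_
    rw [Real.norm_eq_abs, abs_of_nonneg (by positivity)]
    have hb : ‖cexp (t * I * h) - 1‖ ≤ 2 := by
      calc ‖cexp (t * I * h) - 1‖ ≤ ‖cexp (t * I * h)‖ + ‖(1 : ℂ)‖ := norm_sub_le _ _
        _ = 2 := by
          rw [show (t : ℂ) * I * h = ((t * h : ℝ) : ℂ) * I by push_cast; ring, Complex.norm_exp_ofReal_mul_I]; norm_num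
    have hU0 : 0 ≤ U t := by positivity
    have hsq : ‖cexp (t * I * h) - 1‖ ^ 2 ≤ 4 := by nlinarith [norm_nonneg (cexp (t * I * h) - 1)]
    calc U t * ‖cexp (t * I * h) - 1‖ ^ 2 ≤ U t * 4 := mul_le_mul_of_nonneg_left hsq hU0
      _ = 4 * U t := mul_comm _ _
  · refine Eventually.of_forall fun t => ?_
    have hc : Continuous fun h : ℝ => U t * ‖cexp (t * I * h) - 1‖ ^ 2 := by fun_prop
    simpa using hc.tendsto 0

/-- **The autocorrelation of a windowed `L²` function is continuous** (Cauchy–Schwarz against translates: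
`|(u ⋆ ũ)(t + h) − (u ⋆ ũ)(t)| ≤ ‖u‖₂ ‖u(· − h) − u‖₂`). [folklore] -/
theorem continuous_autocorr_of_memLp : ∀ {a : ℝ} {u : ℝ → ℂ}, MemLp u 2 volume → Function.support u ⊆ Icc (-a) a → Continuous (autocorr u) := by
  intro a u hu hsu
  refine continuous_iff_continuousAt.mpr fun t => ?_
  -- `autocorr u (t + h) - autocorr u t = ∫ u s · conj (u (s - t - h) - u (s - t))`
  have hbound : ∀ h : ℝ, ‖autocorr u (t + h) - autocorr u t‖ ≤
      N₂ u * Real.sqrt (∫ x, ‖u (x - h) - u x‖ ^ 2) := by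
    intro h
    set v : ℝ → ℂ := fun x => u (x - h) with hv
    have hv2 : MemLp v 2 volume := hu.comp_measurePreserving (measurePreserving_sub_right volume h)
    have e : autocorr u (t + h) - autocorr u t = ∫ s, u s * conj ((v - u) (s - t)) := by
      rw [autocorr_apply, autocorr_apply,
        ← integral_sub (integrable_mul_of_memLp_two hu (memLp_conj (memLp_comp_sub_right hu (t + h))))
          (integrable_mul_of_memLp_two hu (memLp_conj (memLp_comp_sub_right hu t)))]
      refine integral_congr_ae (Eventually.of_forall fun s => ?_)
      simp only [hv, Pi.sub_apply, map_sub]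
      rw [show s - (t + h) = s - t - h by ring]
      ring
    rw [e]
    refine (norm_integral_mul_conj_sub_le hu (hv2.sub hu) t).trans ?_
    rw [toReal_eLpNorm_two_eq_sqrt (hv2.sub hu)]
    rfl
  have hlim : Tendsto (fun h : ℝ => N₂ u * Real.sqrt (∫ x, ‖u (x - h) - u x‖ ^ 2)) (𝓝 0) (𝓝 0) := by
    have h1 := (Real.continuous_sqrt.tendsto 0).comp (tendsto_integral_norm_sq_translate_sub hu hsu)
    rw [Real.sqrt_zero] at h1
    simpa using h1.const_mul (N₂ u)
  have h2 : Tendsto (fun h : ℝ => autocorr u (t + h)) (𝓝 0) (𝓝 (autocorr u t)) := by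
    rw [tendsto_iff_norm_sub_tendsto_zero]
    exact squeeze_zero (fun h => norm_nonneg _) hbound hlim
  -- `ContinuousAt` from the limit along `t + h`
  have h4 : Tendsto (fun s : ℝ => s - t) (𝓝 t) (𝓝 0) := by
    have := (tendsto_id (x := 𝓝 t)).sub_const t
    simpa using this
  have h3 := h2.comp h4
  simpa [ContinuousAt, Function.comp_def] using h3

end Summit.RiemannHypothesis.RiemannHypothesis.Theorems.SignCone.DualWitness

end
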